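import Mathlib
import Summits.Ventures.PercRepro2.TypedBundleCutRoots
import Summits.Ventures.PercRepro2.TypedTwoTerminalSpine

/-!
# The two-terminal rule composed with every subtraction of S1 (blind cell PercRepro2, p2 g3,
2026-08-25)

`ResidualCoreNHatCT` = the hat landing without a root cut and without a two-terminal part
(unconditional: `HCov_all_of_residualCoreNHatCT_all`); `ResidualCoreFullT` = the same without a
one-star of any degree (conditional on the two certificate bundles, as `ResidualCoreFull`). The
layers above the core compose on `ResidualCoreT` exactly as on `ResidualCore`: a hat class, a root
cut or a one-star is a direct theorem of its instance.
-/

namespace Summit.Ventures.PercRepro2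

open UnionCluster

namespace CovForm

namespace TypedRed

section Core

variable {V : Type*} {E : Type*} [DecidableEq V] [Fintype E] [DecidableEq E]

/-- **The hat landing without a root cut and without a two-terminal part.** -/
structure ResidualCoreNHatCT (ends : E → Sym2 V) (o a₁ a₂ a₃ b : V) (F : Finset E) : Prop where
  coreNHatC : ResidualCoreNHatC ends o a₁ a₂ a₃ b F
  no_twoTerminal : ¬ HasTwoTerminalPart ends o a₁ a₂ a₃ b F

/-- **Every subtraction of S1 together with the two-terminal rule.** -/
structure ResidualCoreFullT (ends : E → Sym2 V) (o a₁ a₂ a₃ b : V) (F : Finset E) : Prop where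
  coreFull : ResidualCoreFull ends o a₁ a₂ a₃ b F
  no_twoTerminal : ¬ HasTwoTerminalPart ends o a₁ a₂ a₃ b F

end Core

section Closure

variable (R : Type*) [Field R] [LinearOrder R] [IsStrictOrderedRing R]

/-- **Row 2′TRI on `ResidualCoreNHatCT`, over every finite graph.** -/
def ResidualCoreNHatCT_all : Prop :=
  ∀ (V E : Type) [Fintype V] [DecidableEq V] [Fintype E] [DecidableEq E]
    (ends : E → Sym2 V) (o a₁ a₂ a₃ b : V) (F : Finset E) (τ : E → ℕ),
    (∀ e ∈ F, τ e = 1 ∨ τ e = 2) → ResidualCoreNHatCT ends o a₁ a₂ a₃ b F →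
      0 ≤ typedCount F (fun _ => false) τ
        (K3 ends o a₁ a₂ a₃ b : Config E → Config E → Config E → R)

/-- **Row 2′TRI on `ResidualCoreFullT`, over every finite graph.** -/
def ResidualCoreFullT_all : Prop :=
  ∀ (V E : Type) [Fintype V] [DecidableEq V] [Fintype E] [DecidableEq E]
    (ends : E → Sym2 V) (o a₁ a₂ a₃ b : V) (F : Finset E) (τ : E → ℕ),
    (∀ e ∈ F, τ e = 1 ∨ τ e = 2) → ResidualCoreFullT ends o a₁ a₂ a₃ b F →
      0 ≤ typedCount F (fun _ => false) τ
        (K3 ends o a₁ a₂ a₃ b : Config E → Config E → Config E → R)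

/-- **THE CRUX OF RECORD FROM (TRI) ON THE HAT LANDING WITHOUT A ROOT CUT AND WITHOUT A
TWO-TERMINAL PART** — unconditional. -/
theorem HCov_all_of_residualCoreNHatCT_all (hc : ResidualCoreNHatCT_all R) : HCov_all R := by
  refine HCov_all_of_residualCoreT_all R ?_
  intro V E _ _ _ _ ends o a₁ a₂ a₃ b F τ hτ hcore
  by_cases hh : Hats ends o a₁ a₂ a₃ b F
  · exact typedCount_nonneg_of_hats F ends o a₁ a₂ a₃ b τ hcore.core.marks
      hcore.core.residualConR.residualCon.residual.reduced.no_loop (fun e he _ => hτ e he) hh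
  by_cases hcut : HasRootCut ends o a₁ a₂ a₃ b F
  · exact typedCount_nonneg_of_hasRootCut ends o a₁ a₂ a₃ b F τ hτ hcut
  · exact hc V E ends o a₁ a₂ a₃ b F τ hτ ⟨⟨⟨hcore.core, hh⟩, hcut⟩, hcore.no_twoTerminal⟩

/-- **CONDITIONAL on the two certificate bundles: the crux of record from (TRI) on the full core
without a two-terminal part.** -/
theorem HCov_all_of_residualCoreFullT_all (h3 : StarCerts R) (h4 : StarCertsGen R)
    (hc : ResidualCoreFullT_all R) : HCov_all R := by
  refine HCov_all_of_residualCoreNHatCT_all R ?_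
  intro V E _ _ _ _ ends o a₁ a₂ a₃ b F τ hτ hcore
  have hred := hcore.coreNHatC.coreNHat.core.residualConR.residualCon.residual.reduced
  by_cases hs : OneStar ends o a₁ a₂ a₃ b F
  · exact typedCount_nonneg_of_oneStar h3 ends o a₁ a₂ a₃ b F τ hτ
      hcore.coreNHatC.coreNHat.core.marks hred.no_loop hred.no_parallel hs
  by_cases hg : OneStarGen ends o a₁ a₂ a₃ b F
  · exact typedCount_nonneg_of_oneStarGen h4 ends o a₁ a₂ a₃ b F τ hτ
      hcore.coreNHatC.coreNHat.core.marks hred.no_loop hred.no_parallel hg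
  · exact hc V E ends o a₁ a₂ a₃ b F τ hτ ⟨⟨hcore.coreNHatC, hs, hg⟩, hcore.no_twoTerminal⟩

end Closure

end TypedRed

end CovForm

end Summit.Ventures.PercRepro2
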